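import Literature.MathematicalPhysics.QuantumLattice.GroundStateInfraredBoundEveryState
import Literature.MathematicalPhysics.QuantumLattice.FinDimSpectrumProofs
import Literature.Barriers.HubbardSuperconductivity.OrderParameterInvisibleToGroundStateConstraints
import Literature.Computation.Certificates.SemidefiniteComplementarity
import HarnessLib

/-!
# Ground-state density matrices are exactly the states supported on the ground space

The certificate vocabulary of the summit `HubbardSuperconductivity` quantifies over "every ground-state
density matrix" `ρ` of a finite-volume Hamiltonian `H` — a density matrix (`ρ ⪰ 0`, `tr ρ = 1`)
minimising the energy `Re tr(ρH)` among all density matrices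
(`Literature.Barriers.HubbardSuperconductivity.IsGroundStateDensityMatrix`, after Scheer–Chadha–Lu–Khalaf,
arXiv:2511.20860, p. 3 eqs. (2)–(3)). The variational argument of Kennedy–Lieb–Shastry in every ground
state (`GroundStateInfraredBoundEveryState.lean`) is stated for `ρ ⪰ 0` with `Hρ = E₀ρ` ("ground-supported").
This file proves that the two notions coincide (finite dimension; the variational principle for states,
Tasaki, *Physics and Mathematics of Quantum Many-Body Systems* (2020) §2.1 / App. A.2, and complementary
slackness for the pair of positive semidefinite matrices `ρ`, `H − E₀`, Blekherman–Parrilo–Thomas (2012)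
App. A Cor. A.24) and re-exports the certified-input mode ceiling in the certificate vocabulary.

* `re_trace_mul_eq_groundEnergy_of_isGroundStateDensityMatrix` — a ground-state density matrix has energy
  `Re tr(ρH) = E₀(H)`.
* `hamiltonian_mul_eq_smul_of_isGroundStateDensityMatrix` — it is ground-supported: `Hρ = E₀ρ`.
* `isGroundStateDensityMatrix_of_hamiltonian_mul_eq_smul` — conversely, a ground-supported density matrix is
  a ground-state density matrix; `isGroundStateDensityMatrix_iff`.
* `isGroundStateDensityMatrix_tracialState` — the tracial state `(tr P₀)⁻¹ P₀` is one.
* `trace_sq_le_half_sqrt_of_isGroundStateDensityMatrix` — the MODE CEILING for every ground-state density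
  matrix: a Gaussian-domination-type energy bound `E₀(H) ≤ E₀(H + tV + ½t²Q)` (all real `t`, `Q ≥ 0`) and a
  double-commutator ceiling `Re tr(ρ[V,[H,V]]) ≤ D` give `Re tr(ρV²) ≤ ½√(QD)`; and
  `trace_mul_eq_zero_of_isGroundStateDensityMatrix` (`tr(ρV) = 0`).

No definition and no named fact is introduced.

## References
* H. Tasaki, *Physics and Mathematics of Quantum Many-Body Systems*, Springer GTP (2020), §2.1, App. A.2
  [Tasaki2020] (ground states of finite systems; the variational principle).
* M. G. Scheer, N. Chadha, D.-C. Lu, E. Khalaf, arXiv:2511.20860 (2025), p. 3 eqs. (2)–(3) [ScheerEtAl2025]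
  (bounds quantified over ground-state density operators).
* G. Blekherman, P. A. Parrilo, R. R. Thomas (eds.), *Semidefinite Optimization and Convex Algebraic
  Geometry*, SIAM (2012), App. A Cor. A.24 [BlekhermanParriloThomas2012] (`⟨A,B⟩ = 0 ⇔ AB = 0` for `A, B ⪰ 0`).
* T. Kennedy, E. H. Lieb, B. S. Shastry, J. Stat. Phys. 53 (1988) 1019 [KLS1988JSP], eqs. (12)–(14).
-/

noncomputable section

open Matrix
open scoped ComplexOrder
open Literature.Barriers.HubbardSuperconductivity (IsDensityMatrix IsGroundStateDensityMatrix)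

namespace Literature.MathematicalPhysics.QuantumLattice

variable {m : Type*} [Fintype m] [DecidableEq m]

/-- For a density matrix `ρ` and Hermitian `H`: `Re tr(ρH) ≥ E₀(H)` — the variational principle for
states (`H − E₀ ⪰ 0` paired with `ρ ⪰ 0`). [cite: Tasaki2020, §2.1 (2.1.6), App. A.2] -/
theorem groundEnergy_le_re_trace_mul_of_isDensityMatrix {H ρ : Matrix m m ℂ} (hH : H.IsHermitian)
    (hρ : IsDensityMatrix ρ) : H.groundEnergy ≤ (ρ * H).trace.re := by
  have hK : (H - (H.groundEnergy : ℂ) • (1 : Matrix m m ℂ)).PosSemidef := by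
    have h := posSemidef_sub_groundEnergy hH
    rwa [Algebra.algebraMap_eq_smul_one, ← Complex.coe_smul] at h
  have h := Literature.LinearAlgebra.Matrix.re_trace_mul_nonneg_of_posSemidef hρ.1 hK
  rw [mul_sub, trace_sub, Matrix.mul_smul, mul_one, trace_smul, smul_eq_mul, hρ.2, mul_one,
    Complex.sub_re, Complex.ofReal_re] at h
  linarith

/-- The tracial state `(tr P₀)⁻¹ P₀` is a density matrix of energy `E₀(H)` (nonempty index type).
[cite: Tasaki2020, §2.1, App. A.2] -/
theorem isDensityMatrix_tracialState {H : Matrix m m ℂ} (hH : H.IsHermitian) [Nonempty m] :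
    IsDensityMatrix ((H.groundProj.trace)⁻¹ • H.groundProj) ∧
      (((H.groundProj.trace)⁻¹ • H.groundProj) * H).trace.re = H.groundEnergy := by
  have htr : 0 < H.groundProj.trace := trace_groundProj_pos hH
  refine ⟨⟨(posSemidef_groundProj H).smul (le_of_lt (inv_pos.2 htr)), ?_⟩, ?_⟩
  · rw [trace_smul, smul_eq_mul, inv_mul_cancel₀ htr.ne']
  · rw [Matrix.smul_mul, trace_smul, smul_eq_mul, ← groundStateFunctional_apply,
      groundStateFunctional_hamiltonian hH, Complex.ofReal_re]

/-- **A ground-state density matrix has the ground energy**: `Re tr(ρH) = E₀(H)` (minimality against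
the tracial state, and the variational principle). [cite: Tasaki2020, §2.1, App. A.2]
[cite: ScheerEtAl2025, p. 3, eqs. (2)–(3)] -/
theorem re_trace_mul_eq_groundEnergy_of_isGroundStateDensityMatrix {H ρ : Matrix m m ℂ}
    (hH : H.IsHermitian) [Nonempty m] (hρ : IsGroundStateDensityMatrix H ρ) :
    (ρ * H).trace.re = H.groundEnergy := by
  refine le_antisymm ?_ (groundEnergy_le_re_trace_mul_of_isDensityMatrix hH hρ.1)
  obtain ⟨hσ, hE⟩ := isDensityMatrix_tracialState hH
  exact (hρ.2 _ hσ).trans hE.le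

/-- **Ground-state density matrices are ground-supported**: `Hρ = E₀(H)ρ` (complementary slackness:
`Re tr(ρ(H − E₀)) = 0` with `ρ, H − E₀ ⪰ 0` forces `(H − E₀)ρ = 0`). [cite: Tasaki2020, §2.1, App. A.2]
[cite: BlekhermanParriloThomas2012, App. A Cor. A.24] -/
theorem hamiltonian_mul_eq_smul_of_isGroundStateDensityMatrix {H ρ : Matrix m m ℂ}
    (hH : H.IsHermitian) [Nonempty m] (hρ : IsGroundStateDensityMatrix H ρ) :
    H * ρ = (H.groundEnergy : ℂ) • ρ := by
  set K : Matrix m m ℂ := H - (H.groundEnergy : ℂ) • 1 with hK_def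
  have hK : K.PosSemidef := by
    have h := posSemidef_sub_groundEnergy hH
    rwa [Algebra.algebraMap_eq_smul_one, ← Complex.coe_smul] at h
  -- `tr(ρK) = 0`: real part by the energy identity, imaginary part since `ρK` has Hermitian factors
  have hre : (ρ * K).trace.re = 0 := by
    rw [hK_def, mul_sub, trace_sub, Matrix.mul_smul, mul_one, trace_smul, smul_eq_mul, hρ.1.2,
      mul_one, Complex.sub_re, Complex.ofReal_re,
      re_trace_mul_eq_groundEnergy_of_isGroundStateDensityMatrix hH hρ, sub_self]
  have him : (ρ * K).trace.im = 0 := by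
    have h : star (ρ * K).trace = (ρ * K).trace := by
      rw [← trace_conjTranspose, conjTranspose_mul, hρ.1.1.1.eq, hK.1.eq, trace_mul_comm]
    have := congrArg Complex.im h
    rw [Complex.star_def, Complex.conj_im] at this
    linarith
  have htr : (ρ * K).trace = 0 := Complex.ext hre him
  have hKρ : K * ρ = 0 :=
    (Literature.Computation.Certificates.SemidefiniteComplementarity.trace_mul_eq_zero_iff' hρ.1.1 hK).1 htr
  rw [hK_def, sub_mul, Matrix.smul_mul, one_mul, sub_eq_zero] at hKρ
  exact hKρ

/-- **Conversely, a ground-supported density matrix is a ground-state density matrix**: if `ρ ⪰ 0`,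
`tr ρ = 1`, `Hρ = E₀ρ`, then `Re tr(ρH) = E₀ ≤ Re tr(σH)` for every density matrix `σ`.
[cite: Tasaki2020, §2.1 (2.1.6), App. A.2] -/
theorem isGroundStateDensityMatrix_of_hamiltonian_mul_eq_smul {H ρ : Matrix m m ℂ} (hH : H.IsHermitian)
    (hρ : IsDensityMatrix ρ) (hHρ : H * ρ = (H.groundEnergy : ℂ) • ρ) : IsGroundStateDensityMatrix H ρ := by
  refine ⟨hρ, fun σ hσ => ?_⟩
  have hρH : ρ * H = (H.groundEnergy : ℂ) • ρ := by
    have h := congrArg conjTranspose hHρ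
    rwa [conjTranspose_mul, conjTranspose_smul, hρ.1.1.eq, hH.eq, Complex.star_def,
      Complex.conj_ofReal] at h
  rw [hρH, trace_smul, smul_eq_mul, hρ.2, mul_one, Complex.ofReal_re]
  exact groundEnergy_le_re_trace_mul_of_isDensityMatrix hH hσ

/-- **Characterisation**: on a nonempty index type, `ρ` is a ground-state density matrix of the Hermitian
`H` iff it is a density matrix with `Hρ = E₀(H)ρ`. [cite: Tasaki2020, §2.1, App. A.2] -/
theorem isGroundStateDensityMatrix_iff {H ρ : Matrix m m ℂ} (hH : H.IsHermitian) [Nonempty m] :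
    IsGroundStateDensityMatrix H ρ ↔ IsDensityMatrix ρ ∧ H * ρ = (H.groundEnergy : ℂ) • ρ :=
  ⟨fun h => ⟨h.1, hamiltonian_mul_eq_smul_of_isGroundStateDensityMatrix hH h⟩,
    fun h => isGroundStateDensityMatrix_of_hamiltonian_mul_eq_smul hH h.1 h.2⟩

/-- The tracial state `(tr P₀)⁻¹ P₀` is a ground-state density matrix. [cite: Tasaki2020, §2.1, App. A.2] -/
theorem isGroundStateDensityMatrix_tracialState {H : Matrix m m ℂ} (hH : H.IsHermitian) [Nonempty m] :
    IsGroundStateDensityMatrix H ((H.groundProj.trace)⁻¹ • H.groundProj) := by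
  refine isGroundStateDensityMatrix_of_hamiltonian_mul_eq_smul hH (isDensityMatrix_tracialState hH).1 ?_
  rw [Matrix.mul_smul, mul_groundProj, smul_comm]

/-! ### The Kennedy–Lieb–Shastry mode bounds for every ground-state density matrix -/

section ModeCeiling

variable {H V ρ : Matrix m m ℂ} {Q : ℝ}

/-- **First order, certificate vocabulary**: a Gaussian-domination-type energy bound
`E₀(H) ≤ E₀(H + tV + ½t²Q)` (all real `t`) forces `tr(ρV) = 0` in EVERY ground-state density matrix.
[cite: KLS1988JSP, eqs. (18)–(19)] -/
theorem trace_mul_eq_zero_of_isGroundStateDensityMatrix (hH : H.IsHermitian) (hV : V.IsHermitian)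
    [Nonempty m] (hρ : IsGroundStateDensityMatrix H ρ)
    (hGD : ∀ t : ℝ, H.groundEnergy ≤
      (H + (t : ℂ) • V + ((t ^ 2 * Q / 2 : ℝ) : ℂ) • (1 : Matrix m m ℂ)).groundEnergy) :
    (ρ * V).trace = 0 :=
  trace_mul_eq_zero_of_gaussianDomination hH hV hρ.1.1
    (hamiltonian_mul_eq_smul_of_isGroundStateDensityMatrix hH hρ) hGD

/-- **The infrared bound in every ground-state density matrix** (double-commutator form):
`(Re tr(ρV²))² ≤ ¼Q · Re tr(ρ[V,[H,V]])`. [cite: KLS1988JSP, eqs. (12)–(13)] -/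
theorem infraredBound_of_isGroundStateDensityMatrix (hH : H.IsHermitian) (hV : V.IsHermitian)
    [Nonempty m] (hρ : IsGroundStateDensityMatrix H ρ)
    (hGD : ∀ t : ℝ, H.groundEnergy ≤
      (H + (t : ℂ) • V + ((t ^ 2 * Q / 2 : ℝ) : ℂ) • (1 : Matrix m m ℂ)).groundEnergy) :
    (ρ * (V * V)).trace.re ^ 2 ≤
      Q / 4 * (ρ * (V * (H * V - V * H) - (H * V - V * H) * V)).trace.re := by
  have h := infraredBound_doubleCommutator_of_groundSupported hH hV hρ.1.1
    (hamiltonian_mul_eq_smul_of_isGroundStateDensityMatrix hH hρ) hGD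
  rwa [hρ.1.2, Complex.one_re, mul_one] at h

/-- **Mode ceiling for every ground-state density matrix** (certified-input form of the
Kennedy–Lieb–Shastry infrared bound): `Q ≥ 0` with `E₀(H) ≤ E₀(H + tV + ½t²Q)` for all real `t`, and
`Re tr(ρ[V,[H,V]]) ≤ D`, give `Re tr(ρV²) ≤ ½√(QD)` — uniformly over the ground-state density matrices `ρ`
of `H`, the objects over which ground-state certificates quantify. [cite: KLS1988JSP, eqs. (12)–(14)]
[cite: ScheerEtAl2025, p. 3, eqs. (2)–(3)] -/
theorem trace_sq_le_half_sqrt_of_isGroundStateDensityMatrix (hH : H.IsHermitian) (hV : V.IsHermitian)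
    [Nonempty m] (hρ : IsGroundStateDensityMatrix H ρ) (hQ : 0 ≤ Q)
    (hGD : ∀ t : ℝ, H.groundEnergy ≤
      (H + (t : ℂ) • V + ((t ^ 2 * Q / 2 : ℝ) : ℂ) • (1 : Matrix m m ℂ)).groundEnergy)
    {D : ℝ} (hD : (ρ * (V * (H * V - V * H) - (H * V - V * H) * V)).trace.re ≤ D) :
    (ρ * (V * V)).trace.re ≤ Real.sqrt (Q * D) / 2 :=
  trace_sq_le_half_sqrt_of_groundSupported hH hV hρ.1.1
    (hamiltonian_mul_eq_smul_of_isGroundStateDensityMatrix hH hρ) hρ.1.2 hQ hGD hD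

end ModeCeiling

end Literature.MathematicalPhysics.QuantumLattice
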